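import Literature.NumberTheory.GaloisRepresentations.FrobeniusDensityTheorem
import Literature.NumberTheory.GaloisRepresentations.HeckeCharacterProofs
import Literature.NumberTheory.LFunctions.NumberFieldDirichletDensity
import Mathlib.NumberTheory.RamificationInertia.Valuation
import Mathlib.NumberTheory.RamificationInertia.Unramified
import Mathlib.FieldTheory.IntermediateField.Adjoin.Basic
import Mathlib.Algebra.Algebra.Hom.Rat
import HarnessLib

/-!
# Degree-one places, unramified residue characteristics, and embeddings into a common number field
# (auxiliaries for the valuation step of Böckle–Hui's Thm. 1.1; proved)

Topic `NumberTheory/GaloisRepresentations`; namespace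
`Literature.NumberTheory.GaloisRepresentations`.  A *proofs* file (theorems only; no definition,
no named fact, no instance).  Auxiliary statements about finite places of a number field `K` used to
pick the auxiliary prime in Step 4 (Prop. 2.12) of the proof of BH Thm. 1.1 for a general number
field:

* `hasDirichletDensity_one_setOf_prime_absNorm` — **the places of prime absolute norm (degree one
  over `ℚ`) have Dirichlet density one** (the tree's strong density only ever counts such places:
  `LFunctions.primeNormCount`, `hasStrongDirichletDensity_univ`);
* `Rat.absNorm_asIdeal_eq_natGenerator'`, `natCast_absNorm_mem_asIdeal`,
  `absNorm_eq_natGenerator_under`, `under_eq_of_natCast_mem` — bookkeeping between a place `v` of `K`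
  of prime norm `p` and the place `(p)` of `ℚ` under it;
* `natCast_not_mem_sq_of_isUnramifiedIn` — if `p` is unramified in `𝓞 K` then `p ∉ 𝔭_v²`
  (`e(v∣p) = 1`), and `finite_setOf_under_mem` — only finitely many places of `K` lie over a finite
  set of places of `ℚ`; so all but finitely many places of prime norm `p` have `p ∈ 𝔭_v ∖ 𝔭_v²`;
* `exists_valuation_comp_eq_pow`, `exists_comap_eq_of_ringHom` — for a ring homomorphism
  `σ : K → F` of number fields and a place `w` of `F`: `|σ(y)|_w = |y|_𝔮^e` for the place
  `𝔮 = σ⁻¹(w)` of `K` and some `e ≥ 1` (Mathlib `valuation_liesOver`), and every place of `K` is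
  `σ⁻¹(w)` for some `w` (going up);
* `exists_intermediateField_forall_mem` — a number field `E` with `e : E → ℚ̄_ℓ` and all the
  embeddings `τ : K → ℚ̄_ℓ` land in a common finite extension `F` of `ℚ` inside `ℚ̄_ℓ`.

## References

* J. Neukirch, *Algebraic Number Theory* (1999), Ch. I §8 (primes of degree one, ramification),
  Ch. VII (13.2) (degree-one primes carry the density). [NeukirchANT1999]
* G. Böckle, C.-Y. Hui, Math. Ann. 393 (2025), §2.7, Prop. 2.12. [BockleHui2025]
-/

noncomputable section

open scoped NumberField
open NumberField IsDedekindDomain IsDedekindDomain.HeightOneSpectrum Filter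
open Rat.HeightOneSpectrum

namespace Literature.NumberTheory.GaloisRepresentations

/-! ### Places of prime absolute norm have density one -/

section Density

variable (K : Type*) [Field K] [NumberField K]

/-- **The places of prime absolute norm have strong Dirichlet density one**: the counting function
`primeNormCount` of the tree's strong density only counts places of norm exactly a prime `p`, so the
set `{v : N v prime}` has the same counting function as the set of all places. [folklore] -/
theorem hasStrongDirichletDensity_setOf_prime_absNorm :
    LFunctions.HasStrongDirichletDensity K
      {v : HeightOneSpectrum (𝓞 K) | (Ideal.absNorm v.asIdeal).Prime} 1 := by
  have h := LFunctions.hasStrongDirichletDensity_univ K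
  have hfun : ∀ p : Nat.Primes, (LFunctions.primeNormCount K
      {v : HeightOneSpectrum (𝓞 K) | (Ideal.absNorm v.asIdeal).Prime} p : ℝ) =
      (LFunctions.primeNormCount K Set.univ p : ℝ) := by
    intro p
    rw [LFunctions.primeNormCount_eq_sum_indicator, LFunctions.primeNormCount_eq_sum_indicator]
    refine Finset.sum_congr rfl fun q hq => ?_
    have hq' : (Ideal.absNorm q.asIdeal).Prime := by
      rw [LFunctions.mem_primesOfNorm.mp hq]
      exact p.2
    rw [Set.indicator_of_mem (show q ∈ {v : HeightOneSpectrum (𝓞 K) |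
        (Ideal.absNorm v.asIdeal).Prime} from hq'), Set.indicator_of_mem (Set.mem_univ q)]
  rw [LFunctions.hasStrongDirichletDensity_iff] at h ⊢
  simp only [hfun]
  exact h

/-- **The places of prime absolute norm have Dirichlet density one** (Neukirch's density,
`LFunctions.NumberField.HasDirichletDensity`). [cite: NeukirchANT1999, Ch. VII (13.2)] -/
theorem hasDirichletDensity_one_setOf_prime_absNorm :
    LFunctions.NumberField.HasDirichletDensity K
      {v : HeightOneSpectrum (𝓞 K) | (Ideal.absNorm v.asIdeal).Prime} 1 :=
  (hasStrongDirichletDensity_setOf_prime_absNorm K).numberField_hasDirichletDensity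

end Density

/-! ### The place of `ℚ` under a place of `K` -/

section Under

variable {K : Type*} [Field K] [NumberField K]

/-- `N((p)) = p` for a place of `ℚ`. [folklore] -/
theorem Rat.absNorm_asIdeal_eq_natGenerator' (u : HeightOneSpectrum (𝓞 ℚ)) :
    Ideal.absNorm u.asIdeal = natGenerator u := by
  rw [Rat.asIdeal_eq_span_natGenerator, Ideal.absNorm_span_singleton,
    ← map_natCast (algebraMap ℤ (𝓞 ℚ)), Algebra.norm_algebraMap, RingOfIntegers.rank,
    Module.finrank_self, pow_one, Int.natAbs_natCast]

/-- The absolute norm of a place lies in it (`N v ∈ 𝔭_v`). [folklore] -/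
theorem natCast_absNorm_mem_asIdeal (v : HeightOneSpectrum (𝓞 K)) :
    ((Ideal.absNorm v.asIdeal : ℕ) : 𝓞 K) ∈ v.asIdeal :=
  Ideal.absNorm_mem v.asIdeal

/-- For a place `v` of prime norm `p`, the place of `ℚ` under `v` is `(p)` and `f(v∣p) = 1`.
[folklore] -/
theorem absNorm_eq_natGenerator_under (v : HeightOneSpectrum (𝓞 K))
    (hv : (Ideal.absNorm v.asIdeal).Prime) :
    Ideal.absNorm v.asIdeal = natGenerator (v.under (𝓞 ℚ)) := by
  have h := (inertiaDeg_eq_one_of_prime_absNorm (M := ℚ) v hv).2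
  rw [← h, Rat.absNorm_asIdeal_eq_natGenerator']

/-- The place of `ℚ` containing the prime `p` is unique. [folklore] -/
theorem Rat.eq_of_natCast_prime_mem {u u' : HeightOneSpectrum (𝓞 ℚ)} {p : ℕ} (hp : p.Prime)
    (hu : (p : 𝓞 ℚ) ∈ u.asIdeal) (hu' : (p : 𝓞 ℚ) ∈ u'.asIdeal) : u = u' := by
  rw [Rat.natCast_mem_asIdeal_iff] at hu hu'
  have h1 : natGenerator u = p := (Nat.prime_dvd_prime_iff_eq (prime_natGenerator u) hp).mp hu
  have h2 : natGenerator u' = p := (Nat.prime_dvd_prime_iff_eq (prime_natGenerator u') hp).mp hu'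
  exact Rat.natGenerator_injective (h1.trans h2.symm)

/-- If the prime `p` lies in `𝔭_w` then the place of `ℚ` under `w` is `(p)`: it is the unique place
containing `p`. [folklore] -/
theorem natGenerator_under_eq_of_natCast_mem {F : Type*} [Field F] [NumberField F]
    (w : HeightOneSpectrum (𝓞 F)) {p : ℕ} (hp : p.Prime) (hw : (p : 𝓞 F) ∈ w.asIdeal) :
    natGenerator (w.under (𝓞 ℚ)) = p := by
  have h1 : ((p : ℕ) : 𝓞 ℚ) ∈ (w.under (𝓞 ℚ)).asIdeal := by
    change algebraMap (𝓞 ℚ) (𝓞 F) (p : 𝓞 ℚ) ∈ w.asIdeal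
    rwa [map_natCast]
  rw [Rat.natCast_mem_asIdeal_iff] at h1
  exact (Nat.prime_dvd_prime_iff_eq (prime_natGenerator _) hp).mp h1

/-- **`p ∉ 𝔭_w²` when `p ∈ 𝔭_w` is unramified in `𝓞 F`** (`e(w∣p) = 1`: the multiplicity of `𝔭_w` in
`p 𝓞_F` is the ramification index, Mathlib `ramificationIdx_eq_normalizedFactors_count`,
`IsUnramifiedIn.ramificationIdx_eq_one`). [cite: NeukirchANT1999, Ch. I §8] -/
theorem natCast_not_mem_sq_of_isUnramifiedIn {F : Type*} [Field F] [NumberField F]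
    (w : HeightOneSpectrum (𝓞 F)) {p : ℕ} (hp : p.Prime) (hw : (p : 𝓞 F) ∈ w.asIdeal)
    (hunr : Algebra.IsUnramifiedIn (𝓞 F) (w.under (𝓞 ℚ)).asIdeal) :
    (p : 𝓞 F) ∉ w.asIdeal ^ 2 := by
  classical
  set u : HeightOneSpectrum (𝓞 ℚ) := w.under (𝓞 ℚ) with hu
  haveI : w.asIdeal.LiesOver u.asIdeal := ⟨rfl⟩
  haveI := w.isPrime
  have hgen : natGenerator u = p := natGenerator_under_eq_of_natCast_mem w hp hw
  have hmap : u.asIdeal.map (algebraMap (𝓞 ℚ) (𝓞 F)) = Ideal.span {(p : 𝓞 F)} := by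
    rw [Rat.asIdeal_eq_span_natGenerator, Ideal.map_span, Set.image_singleton, map_natCast, hgen]
  have hne : u.asIdeal.map (algebraMap (𝓞 ℚ) (𝓞 F)) ≠ ⊥ := by
    rw [hmap, Ne, Ideal.span_singleton_eq_bot, Nat.cast_eq_zero]
    exact hp.ne_zero
  have he : w.asIdeal.ramificationIdx (𝓞 ℚ) = 1 := hunr.ramificationIdx_eq_one ⟨rfl⟩
  have hcount : (UniqueFactorizationMonoid.normalizedFactors (Ideal.span {(p : 𝓞 F)})).count
      w.asIdeal = 1 := by
    rw [← hmap, ← Ideal.IsDedekindDomain.ramificationIdx_eq_normalizedFactors_count u.asIdeal w.asIdeal hne]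
    exact he
  intro hmem
  have hdvd : w.asIdeal ^ 2 ∣ Ideal.span {(p : 𝓞 F)} := Ideal.dvd_span_singleton.mpr hmem
  have hp0 : Ideal.span {(p : 𝓞 F)} ≠ 0 := by
    rw [← hmap]
    exact hne
  have h2 := pow_dvd_iff_le_emultiplicity.mp hdvd
  rw [UniqueFactorizationMonoid.emultiplicity_eq_count_normalizedFactors w.irreducible hp0,
    normalize_eq, hcount] at h2
  norm_num at h2

/-- **Only finitely many places of `K` lie over a finite set of places of `ℚ`** (each rational prime
has finitely many primes of `K` above it, Mathlib `primesOver_finite`). [folklore] -/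
theorem finite_setOf_under_mem {B : Set (HeightOneSpectrum (𝓞 ℚ))} (hB : B.Finite) :
    {v : HeightOneSpectrum (𝓞 K) | v.under (𝓞 ℚ) ∈ B}.Finite := by
  have h : {v : HeightOneSpectrum (𝓞 K) | v.under (𝓞 ℚ) ∈ B} ⊆
      ⋃ u ∈ B, {v : HeightOneSpectrum (𝓞 K) | v.asIdeal ∈ u.asIdeal.primesOver (𝓞 K)} := by
    intro v hv
    simp only [Set.mem_iUnion, Set.mem_setOf_eq]
    exact ⟨v.under (𝓞 ℚ), hv, v.isPrime, ⟨rfl⟩⟩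
  refine (hB.biUnion fun u _ => ?_).subset h
  have hf := IsDedekindDomain.primesOver_finite u.asIdeal (𝓞 K)
  refine (hf.preimage ?_ : {v : HeightOneSpectrum (𝓞 K) | v.asIdeal ∈ u.asIdeal.primesOver (𝓞 K)}.Finite)
  exact fun v _ v' _ h => HeightOneSpectrum.ext h

/-- **All but finitely many places of prime norm `p` have `p ∉ 𝔭_v²`** (and `p ∈ 𝔭_v`): the
exceptions lie over the finitely many rational primes ramified in `K`. [cite: NeukirchANT1999, Ch. I §8] -/
theorem eventually_natCast_absNorm_not_mem_sq :
    ∀ᶠ v : HeightOneSpectrum (𝓞 K) in cofinite, (Ideal.absNorm v.asIdeal).Prime →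
      ((Ideal.absNorm v.asIdeal : ℕ) : 𝓞 K) ∉ v.asIdeal ^ 2 := by
  have hfin := finite_setOf_under_mem (K := K) (finite_setOf_not_isUnramifiedIn ℚ K)
  refine (Filter.eventually_cofinite.mpr (hfin.subset ?_))
  intro v hv
  simp only [Set.mem_setOf_eq, Classical.not_imp, not_not] at hv ⊢
  obtain ⟨hprime, hmem⟩ := hv
  by_contra hunr
  exact natCast_not_mem_sq_of_isUnramifiedIn v hprime (natCast_absNorm_mem_asIdeal v) hunr hmem

end Under

/-! ### Valuations along a ring homomorphism of number fields -/

section RingHom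

variable {K F : Type*} [Field K] [NumberField K] [Field F] [NumberField F]

/-- **`|σ(y)|_w = |y|_𝔮^e` along a ring homomorphism `σ : K → F`**, for the place `𝔮 = σ⁻¹(w)` of
`K` under the place `w` of `F` and the ramification index `e ≥ 1` (Mathlib `valuation_liesOver`,
with `F` a `K`-algebra through `σ`). [folklore] -/
theorem exists_valuation_comp_eq_pow (σ : K →+* F) (w : HeightOneSpectrum (𝓞 F)) :
    ∃ (𝔮 : HeightOneSpectrum (𝓞 K)) (e : ℕ), 0 < e ∧
      𝔮.asIdeal = Ideal.comap (RingOfIntegers.mapRingHom σ) w.asIdeal ∧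
      ∀ y : K, w.valuation F (σ y) = (𝔮.valuation K y) ^ e := by
  letI : Algebra K F := σ.toAlgebra
  let 𝔮 : HeightOneSpectrum (𝓞 K) := w.under (𝓞 K)
  haveI : w.asIdeal.LiesOver 𝔮.asIdeal := ⟨rfl⟩
  haveI := w.isPrime
  refine ⟨𝔮, Ideal.ramificationIdx' 𝔮.asIdeal w.asIdeal, Nat.pos_of_ne_zero
    (Ideal.IsDedekindDomain.ramificationIdx'_ne_zero_of_liesOver w.asIdeal 𝔮.ne_bot), rfl, fun y => ?_⟩
  rw [valuation_liesOver F 𝔮 w y]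
  rfl

omit [NumberField F] in
/-- **Going up along a ring homomorphism**: every place `v` of `K` is `σ⁻¹(w)` for some place `w`
of `F`. [folklore] -/
theorem exists_comap_eq_of_ringHom (σ : K →+* F) (v : HeightOneSpectrum (𝓞 K)) :
    ∃ w : HeightOneSpectrum (𝓞 F), Ideal.comap (RingOfIntegers.mapRingHom σ) w.asIdeal = v.asIdeal := by
  letI : Algebra K F := σ.toAlgebra
  haveI := v.isMaximal
  obtain ⟨Q, hQmax, hQover⟩ := Ideal.exists_maximal_ideal_liesOver_of_isIntegral (S := 𝓞 F) v.asIdeal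
  have hQne : Q ≠ ⊥ := Ideal.ne_bot_of_liesOver_of_ne_bot v.ne_bot Q
  exact ⟨⟨Q, hQmax.isPrime, hQne⟩, hQover.over.symm⟩

omit [NumberField K] in
/-- Along `σ`, integers of `K` are `w`-integral: `|σ(a)|_w ≤ 1` for `a ∈ 𝓞 K`. [folklore] -/
theorem valuation_ringHom_coe_le_one (σ : K →+* F) (w : HeightOneSpectrum (𝓞 F)) (a : 𝓞 K) :
    w.valuation F (σ (a : K)) ≤ 1 := by
  have h : σ (a : K) = ((RingOfIntegers.mapRingHom σ a : 𝓞 F) : F) := rfl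
  rw [h]
  exact valuation_le_one w _

omit [NumberField K] in
/-- Along `σ`, `|σ(a)|_w < 1` iff `a ∈ σ⁻¹(w)`, for `a ∈ 𝓞 K`. [folklore] -/
theorem valuation_ringHom_coe_lt_one_iff (σ : K →+* F) (w : HeightOneSpectrum (𝓞 F)) (a : 𝓞 K) :
    w.valuation F (σ (a : K)) < 1 ↔ a ∈ Ideal.comap (RingOfIntegers.mapRingHom σ) w.asIdeal := by
  have h : σ (a : K) = ((RingOfIntegers.mapRingHom σ a : 𝓞 F) : F) := rfl
  rw [h, Ideal.mem_comap]
  exact valuation_lt_one_iff_mem w _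

end RingHom

/-! ### A common finite extension containing `e(E)` and all `τ(K)` -/

section Common

variable {ℓ : ℕ} [Fact ℓ.Prime]

/-- The image of a number field under a ring homomorphism into a characteristic-zero field lies in
the subfield generated by the image of a `ℚ`-basis. [folklore] -/
theorem RingHom.apply_mem_adjoin_image_basis {E A : Type*} [Field E] [NumberField E] [Field A]
    [CharZero A] (e : E →+* A) {ι : Type*} [Fintype ι] (b : Module.Basis ι ℚ E)
    (F : IntermediateField ℚ A) (hF : ∀ i, e (b i) ∈ F) (x : E) : e x ∈ F := by
  have hx : x = ∑ i, b.repr x i • b i := (b.sum_repr x).symm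
  rw [hx, map_sum]
  refine IntermediateField.sum_mem F fun i _ => ?_
  rw [map_rat_smul]
  exact IntermediateField.smul_mem F (hF i)

/-- **A common finite extension.**  For number fields `E`, `K` and a ring homomorphism
`e : E → ℚ̄_ℓ` there is a finite extension `F` of `ℚ` inside `ℚ̄_ℓ` containing `e(E)` and `τ(K)`
for every ring homomorphism `τ : K → ℚ̄_ℓ` (adjoin the images of `ℚ`-bases: finitely many algebraic
elements). [folklore] -/
theorem exists_intermediateField_forall_mem (E K : Type*) [Field E] [NumberField E] [Field K]
    [NumberField K] (e : E →+* PadicAlgCl ℓ) :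
    ∃ F : IntermediateField ℚ (PadicAlgCl ℓ), FiniteDimensional ℚ F ∧
      (∀ x : E, e x ∈ F) ∧ ∀ (τ : K →+* PadicAlgCl ℓ) (y : K), τ y ∈ F := by
  classical
  let bE := Module.finBasis ℚ E
  let bK := Module.finBasis ℚ K
  let S : Set (PadicAlgCl ℓ) :=
    (Set.range fun i => e (bE i)) ∪ ⋃ τ : K →+* PadicAlgCl ℓ, Set.range fun j => τ (bK j)
  haveI : Finite S := by
    refine Set.Finite.to_subtype ?_
    exact (Set.finite_range _).union (Set.finite_iUnion fun τ => Set.finite_range _)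
  have hS : ∀ x ∈ S, IsIntegral ℚ x := by
    rintro x (⟨i, rfl⟩ | hx)
    · exact ((Algebra.IsAlgebraic.isAlgebraic (R := ℚ) (bE i)).algHom e.toRatAlgHom).isIntegral
    · simp only [Set.mem_iUnion, Set.mem_range] at hx
      obtain ⟨τ, j, rfl⟩ := hx
      exact ((Algebra.IsAlgebraic.isAlgebraic (R := ℚ) (bK j)).algHom τ.toRatAlgHom).isIntegral
  refine ⟨IntermediateField.adjoin ℚ S, IntermediateField.finiteDimensional_adjoin hS, ?_, ?_⟩
  · intro x
    refine RingHom.apply_mem_adjoin_image_basis e bE _ (fun i => ?_) x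
    exact IntermediateField.subset_adjoin ℚ S (Or.inl ⟨i, rfl⟩)
  · intro τ y
    refine RingHom.apply_mem_adjoin_image_basis τ bK _ (fun j => ?_) y
    refine IntermediateField.subset_adjoin ℚ S (Or.inr ?_)
    simp only [Set.mem_iUnion, Set.mem_range]
    exact ⟨τ, j, rfl⟩

end Common

end Literature.NumberTheory.GaloisRepresentations
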